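import Literature.Geometry.Kaehler.RiemannSurfacePeriodLatticeRank
import Mathlib.Topology.Separation.Lemmas
import HarnessLib

/-!
# The Abel–Jacobi map of a compact Riemann surface of genus `g ≥ 1` is not constant
# (Farkas–Kra III.6.4: «`φ` … is not constant»; `A ≡ 0` iff `g = 0`, Miranda VIII Example 1.3)

Layer `Literature/Geometry/Kaehler`, sequel WITHOUT definitions of `RiemannSurfaceJacobian` (the
Abel–Jacobi map `abelJacobi x₀ : M → Jacobian x₀ = Ω¹(X)^*/Λ`, `abelJacobi_proj : A(p) = [Ã(p̃)]`,
`abelJacobiLift_apply : Ã(p̃)(ω) = F_ω(p̃)` the development of `ω` on the universal cover),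
`RiemannSurfacePeriodMapping` (`continuous_development`, `isDevelopment_development`),
`RiemannSurfaceGenusZeroClassification` (the maximum principle for developments,
`IsDevelopment.eq_zero_of_isMax_re_of_isOpenMap`) and `RiemannSurfacePeriodLatticeRank`
(`countable_periods`: `Λ` is countable; `nontrivial_jacobian_iff`).

H. M. Farkas, I. Kra, *Riemann Surfaces*, GTM 71, 2nd ed. (1992), III.6.4 Corollary 1, proof (held copy
p0089): «Clearly `φ` is surjective (since it is not constant).» — the map `φ : M → J(M)` of III.6.1 being
the Abel–Jacobi map. R. Miranda, *Algebraic Curves and Riemann Surfaces* (1995), Chapter VIII §1 Example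
1.3: «The Jacobian of the Riemann Sphere is trivial».

THE ARGUMENT (not spelled out in the sources, which know `J(M)` to be a complex torus and `φ` holomorphic
of maximal rank): if `A ≡ A(x₀) = 0` then every lifted value `Ã(p̃) ∈ Ω¹(X)^*` is a period, so for each
holomorphic `ω` the development `F_ω : M̃ → ℂ` — a continuous function on the connected space `M̃` —
takes values in the COUNTABLE set `{λ(ω) : λ ∈ Λ}`; a countable subset of `ℂ` is totally disconnected,
so `F_ω` is constant, its real part attains a maximum, and `ω = 0` by the maximum principle for
developments. Hence `Ω¹(X) = 0`, `g = 0`: **`arithGenus_eq_zero_of_forall_abelJacobi_eq_zero`**,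
**`forall_abelJacobi_eq_zero_iff : A ≡ 0 ↔ g = 0`**, **`exists_abelJacobi_ne_zero`** («`φ` is not
constant» for `g ≠ 0`), `exists_abelJacobi_ne`.

No definitions, no instances, no named facts.

## References

* H. M. Farkas, I. Kra, *Riemann Surfaces*, GTM 71, 2nd ed., Springer (1992), III.6.1, III.6.4 Corollary 1
  (proof, held copy p0089). [FarkasKra1992]
* R. Miranda, *Algebraic Curves and Riemann Surfaces*, GSM 5, AMS (1995), Chapter VIII §1 Example 1.3,
  §2 («The Abel-Jacobi Map»). [Miranda1995]
-/

noncomputable section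

open scoped Manifold ContDiff Topology
open Set Filter Function Complex

namespace Literature.Geometry.Kaehler

namespace RiemannSurface

open Literature.Topology.CoveringSpaces Literature.AlgebraicTopology.Homotopy MeromorphicOneForm

universe u

variable {M : Type u} [TopologicalSpace M] [ChartedSpace ℂ M] [ConnectedSpace M] [IsManifold 𝓘(ℂ, ℂ) ω M]
  [T2Space M] [CompactSpace M] (x₀ : M)

/-- **A holomorphic differential all of whose «integrals from `x₀`» are periods vanishes**: if every
lifted Abel–Jacobi value `Ã(p̃)`, `p̃ ∈ M̃`, lies in `Λ`, then `Ω¹(X) = 0` — the development of each `ω`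
is a continuous function on the connected `M̃` with values in the countable set `Λ(ω)`, hence constant,
and the maximum principle gives `ω = 0`. [cite: FarkasKra1992, III.6.4 Corollary 1 (proof: «`φ` … is not constant»), III.3.3 Proposition] -/
theorem eq_zero_of_forall_abelJacobiLift_mem
    (h : ∀ a : UniversalCover M x₀, abelJacobiLift x₀ a ∈ periods x₀) (θ : ↥(holomorphicOneForms M)) :
    (θ : MeromorphicOneForm M) = 0 := by
  haveI := countable_periods x₀
  have hθ : (θ : MeromorphicOneForm M).IsHolomorphic := mem_holomorphicOneForms_iff.1 θ.2
  set F := development x₀ (θ : MeromorphicOneForm M) with hF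
  -- the values of `F` are the numbers `λ(ω)`, `λ ∈ Λ`
  have hmem : Set.range F ⊆ Set.range fun l : ↥(periods x₀) ↦ (l : Module.Dual ℂ ↥(holomorphicOneForms M)) θ := by
    rintro _ ⟨a, rfl⟩
    exact ⟨⟨abelJacobiLift x₀ a, h a⟩, rfl⟩
  have hsub : (Set.range F).Subsingleton :=
    (Set.countable_range _).isTotallyDisconnected _ hmem (isPreconnected_range (continuous_development _))
  exact (isDevelopment_development hθ).eq_zero_of_isMax_re_of_isOpenMap
    (Kaehler.UniversalCover.isCoveringMap_proj_riemannSurface x₀).isLocalHomeomorph.isOpenMap hθ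
    (a₀ := UniversalCover.base M x₀) fun a ↦
      (congrArg Complex.re (hsub (mem_range_self (f := F) a) (mem_range_self (UniversalCover.base M x₀)))).le

/-- **If the Abel–Jacobi map is identically `0` (= `A(x₀)`), then `g = 0`.**
[cite: FarkasKra1992, III.6.4 Corollary 1 (proof: «`φ` … is not constant»)] [cite: Miranda1995, Chapter VIII §1 Example 1.3] -/
theorem arithGenus_eq_zero_of_forall_abelJacobi_eq_zero (h : ∀ p, abelJacobi x₀ p = 0) : arithGenus M = 0 := by
  have hΛ : ∀ a : UniversalCover M x₀, abelJacobiLift x₀ a ∈ periods x₀ := fun a ↦ by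
    rw [← QuotientAddGroup.eq_zero_iff, ← abelJacobi_proj]
    exact h _
  have hbot : holomorphicOneForms M = ⊥ :=
    (Submodule.eq_bot_iff _).2 fun θ hθ ↦ eq_zero_of_forall_abelJacobiLift_mem x₀ hΛ ⟨θ, hθ⟩
  rw [← finrank_holomorphicOneForms_eq_arithGenus, hbot, finrank_bot]

/-- **`A ≡ 0 ↔ g = 0`** (for `g = 0`, `Jac(X) = 0`). [cite: Miranda1995, Chapter VIII §1 Example 1.3] [cite: FarkasKra1992, III.6.4 Corollary 1 (proof)] -/
theorem forall_abelJacobi_eq_zero_iff : (∀ p, abelJacobi x₀ p = 0) ↔ arithGenus M = 0 := by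
  refine ⟨arithGenus_eq_zero_of_forall_abelJacobi_eq_zero x₀, fun hg p ↦ ?_⟩
  have hs : ¬ Nontrivial (Jacobian x₀) := fun hn ↦ (nontrivial_jacobian_iff x₀).1 hn hg
  haveI : Subsingleton (Jacobian x₀) := not_nontrivial_iff_subsingleton.1 hs
  exact Subsingleton.elim _ _

/-- **«`φ` is not constant»: for `g ≠ 0` some point has non-zero Abel–Jacobi image.**
[cite: FarkasKra1992, III.6.4 Corollary 1 (proof: «Clearly `φ` is surjective (since it is not constant)»)] -/
theorem exists_abelJacobi_ne_zero (hg : arithGenus M ≠ 0) : ∃ p, abelJacobi x₀ p ≠ 0 := by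
  by_contra h
  push Not at h
  exact hg ((forall_abelJacobi_eq_zero_iff x₀).1 h)

/-- The Abel–Jacobi map of a surface of genus `g ≠ 0` takes at least two values.
[cite: FarkasKra1992, III.6.4 Corollary 1 (proof)] -/
theorem exists_abelJacobi_ne (hg : arithGenus M ≠ 0) : ∃ p q, abelJacobi x₀ p ≠ abelJacobi x₀ q := by
  obtain ⟨p, hp⟩ := exists_abelJacobi_ne_zero x₀ hg
  exact ⟨p, x₀, by rwa [abelJacobi_base]⟩

end RiemannSurface

end Literature.Geometry.Kaehler
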